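import Literature.Analysis.FluidPDE.SelfSimilarEulerVorticityExterior
import Literature.Analysis.FluidPDE.HarmonicLiouvilleSublinear
import Literature.Analysis.FluidPDE.SelfSimilarEulerLpExclusion
import Literature.Analysis.FluidPDE.VectorCalculusProofs
import Literature.Analysis.FluidPDE.LerayProfileCalculus
import HarnessLib

/-!
# Chae–Shvydkoy 2013, Theorem 4.1 (vorticity criterion) — the named fact discharged

Analysis/FluidPDE proofs file (theorems only; no definitions, no named facts). It DISCHARGES the
named fact `Literature.Analysis.FluidPDE.chaeShvydkoy2013_vorticity_exclusion`
(`SelfSimilarEulerLpExclusion.lean`): D. Chae, R. Shvydkoy, *On formation of a locally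
self-similar collapse in the incompressible Euler equations*, ARMA 209 (2013) = arXiv:1201.6009,
**Theorem 4.1** — a `C²` stationary self-similar Euler profile `(U, P)` (exponent `γ = 1/(α+1)`,
`α > −1`, centre `0`) whose strain `½(DU + DUᵀ)` tends to `0` at infinity and whose vorticity
`curl U` lies in `L^p(ℝ³)` for some `0 < p < 3/(1+α)` is a constant vector field.

Assembly of the tree's three steps:
1. `IsSelfSimilarEulerVorticityProfile.hasCompactSupport_curl_of_integrable_rpow`
   (`SelfSimilarEulerVorticityExterior`): the exterior weighted `L^p` identity ⇒ `curl U` has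
   compact support — its transport/stretching hypotheses are derived HERE from the strain
   condition: along rays `t ↦ ⟪U(ty), y⟫` has derivative `⟪DU(ty) y, y⟫ = ⟪ς(ty) y, y⟫`, so
   `|⟪U(y), y⟫ − ⟪U(0), y⟫| ≤ S r |y| + δ |y|²` once `‖ς‖ ≤ δ` off `B(0, r)` (`‖ς‖ ≤ S` everywhere)
   — CS13 (4.1) "`|v_r(y)| = o(|y|)`" —, whence `⟪γy + U(y), y⟫ ≥ 0` for `|y|` large and
   `= O(1 + |y|²)`; and `|⟪Ω, DU Ω⟫| = |⟪ς Ω, Ω⟫| ≤ ‖ς‖ |Ω|²` is eventually `≤ η |Ω|²`.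
2. `IsSelfSimilarEulerVorticityProfile.curl_eq_zero_of_hasCompactSupport`
   (`SelfSimilarEulerVorticityCompactSupport`): compactly supported vorticity vanishes (`γ > 0`).
3. `eq_of_curl_eq_zero_of_isDivFree_of_fderiv_tendsto_zero` (`HarmonicLiouvilleSublinear`): with
   `curl U = 0` the Jacobian is symmetric (`‖curl‖² = ½|DU − DUᵀ|²`,
   `norm_curl_sq_eq_frobeniusNormSq_spin_holds`), so `DU = ς → 0`, and an irrotational
   incompressible field with `DU → 0` is constant.

* `inner_apply_self_eq_inner_strain_apply_self`, `abs_inner_apply_self_le_norm_strain_mul` — the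
  quadratic form of a linear map only sees its symmetric part;
* `abs_inner_sub_inner_zero_le_of_strain` — the radial estimate along rays (two-piece mean value
  inequality);
* `fderiv_eq_strain_of_curl_eq_zero` — `curl U y = 0 ⇒ DU(y) = ½(DU(y) + DU(y)ᵀ)`;
* `chaeShvydkoy2013_vorticity_exclusion_holds` — **the fact**.

## References

* D. Chae, R. Shvydkoy, ARMA 209 (2013) = arXiv:1201.6009, §4 Thm 4.1 and its proof.
  [ChaeShvydkoy2013]
-/

noncomputable section

open MeasureTheory Set Filter Function Topology InnerProductSpace Metric
open scoped RealInnerProductSpace NNReal ENNReal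

namespace Literature.Analysis.FluidPDE

/-! ### The quadratic form of a linear map and its symmetric part -/

section Strain

variable {E : Type*} [NormedAddCommGroup E] [InnerProductSpace ℝ E] [CompleteSpace E]

/-- `⟪L v, v⟫ = ⟪ς v, v⟫` with `ς = ½(L + L†)` the symmetric part (the antisymmetric part has zero
quadratic form). [folklore] -/
private theorem inner_apply_self_eq_inner_strain_apply_self (L : E →L[ℝ] E) (v : E) :
    ⟪L v, v⟫ = ⟪((1 / 2 : ℝ) • (L + ContinuousLinearMap.adjoint L)) v, v⟫ := by
  rw [_root_.smul_apply, _root_.add_apply, inner_smul_left, inner_add_left,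
    ContinuousLinearMap.adjoint_inner_left, real_inner_comm (L v)]
  simp only [conj_trivial]
  ring

/-- `|⟪L v, v⟫| ≤ ‖½(L + L†)‖ ‖v‖²`: the quadratic form is controlled by the norm of the symmetric
part alone (the reason only the STRAIN enters Chae–Shvydkoy's condition (i)). [cite: ChaeShvydkoy2013, §4 Thm 4.1 (condition (i))] -/
theorem abs_inner_apply_self_le_norm_strain_mul (L : E →L[ℝ] E) (v : E) :
    |⟪L v, v⟫| ≤ ‖(1 / 2 : ℝ) • (L + ContinuousLinearMap.adjoint L)‖ * ‖v‖ ^ 2 := by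
  rw [inner_apply_self_eq_inner_strain_apply_self L v]
  calc |⟪((1 / 2 : ℝ) • (L + ContinuousLinearMap.adjoint L)) v, v⟫|
      ≤ ‖((1 / 2 : ℝ) • (L + ContinuousLinearMap.adjoint L)) v‖ * ‖v‖ := abs_real_inner_le_norm _ _
    _ ≤ ‖(1 / 2 : ℝ) • (L + ContinuousLinearMap.adjoint L)‖ * ‖v‖ * ‖v‖ :=
        mul_le_mul_of_nonneg_right (ContinuousLinearMap.le_opNorm _ _) (norm_nonneg _)
    _ = ‖(1 / 2 : ℝ) • (L + ContinuousLinearMap.adjoint L)‖ * ‖v‖ ^ 2 := by ring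

end Strain

/-! ### The radial estimate along rays (CS13 (4.1)) -/

section Radial

variable {E : Type*} [NormedAddCommGroup E] [InnerProductSpace ℝ E]

/-- **Radial estimate along rays.** If `U : E → E` is differentiable with quadratic-form bounds
`|⟪DU(z) w, w⟫| ≤ S ‖w‖²` for all `z` and `|⟪DU(z) w, w⟫| ≤ δ ‖w‖²` for `‖z‖ ≥ r` (`0 ≤ r`,
`0 ≤ δ`), then `|⟪U y, y⟫ − ⟪U 0, y⟫| ≤ S r ‖y‖ + δ ‖y‖²` for every `y`: apply the mean value
inequality to `g(t) = ⟪U(t y), y⟫`, `g'(t) = ⟪DU(ty) y, y⟫`, on `[0, r/‖y‖]` and `[r/‖y‖, 1]`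
(CS13 (4.1): "`v_r(y) = v(0)·y/|y| + |y|⁻¹ ∫₀¹ y·ς(ty)·y dt`, hence `|v_r(y)| = o(|y|)`").
[cite: ChaeShvydkoy2013, §4, proof of Thm 4.1 (display (4.1))] -/
theorem abs_inner_sub_inner_zero_le_of_strain {U : E → E} (hU : Differentiable ℝ U)
    {S δ r : ℝ} (hS0 : 0 ≤ S) (hS : ∀ z w : E, |⟪fderiv ℝ U z w, w⟫| ≤ S * ‖w‖ ^ 2) (hδ : 0 ≤ δ)
    (hr : 0 ≤ r) (hsmall : ∀ z : E, r ≤ ‖z‖ → ∀ w : E, |⟪fderiv ℝ U z w, w⟫| ≤ δ * ‖w‖ ^ 2)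
    (y : E) : |⟪U y, y⟫ - ⟪U 0, y⟫| ≤ S * r * ‖y‖ + δ * ‖y‖ ^ 2 := by
  -- the radial function and its derivative
  set g : ℝ → ℝ := fun t => ⟪U (t • y), y⟫ with hg
  have hgd : ∀ t : ℝ, HasDerivAt g (⟪fderiv ℝ U (t • y) y, y⟫) t := by
    intro t
    have h1 : HasDerivAt (fun s : ℝ => s • y) ((1 : ℝ) • y) t := (hasDerivAt_id t).smul_const y
    rw [one_smul] at h1
    have h2 : HasDerivAt (fun s : ℝ => U (s • y)) (fderiv ℝ U (t • y) y) t :=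
      (hU (t • y)).hasFDerivAt.comp_hasDerivAt t h1
    have h3 := h2.inner ℝ (hasDerivAt_const t y)
    simpa [hg] using h3
  have hg0 : g 0 = ⟪U 0, y⟫ := by simp [hg]
  have hg1 : g 1 = ⟪U y, y⟫ := by simp [hg]
  -- mean value inequality on a subinterval `[s₁, s₂] ⊆ [0, 1]` with a derivative bound `K ‖y‖²`
  have mvt : ∀ s₁ s₂ K : ℝ, s₁ ≤ s₂ → (∀ t ∈ Ico s₁ s₂, |⟪fderiv ℝ U (t • y) y, y⟫| ≤ K * ‖y‖ ^ 2) →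
      |g s₂ - g s₁| ≤ K * ‖y‖ ^ 2 * (s₂ - s₁) := by
    intro s₁ s₂ K hs hK
    have h := norm_image_sub_le_of_norm_deriv_le_segment' (f := g)
      (fun t _ => (hgd t).hasDerivWithinAt) (fun t ht => by rw [Real.norm_eq_abs]; exact hK t ht)
      s₂ (right_mem_Icc.2 hs)
    rwa [Real.norm_eq_abs] at h
  rw [← hg1, ← hg0]
  by_cases hy : ‖y‖ ≤ r
  · -- one piece, bound `S`
    have h := mvt 0 1 S zero_le_one fun t _ => hS _ _
    calc |g 1 - g 0| ≤ S * ‖y‖ ^ 2 * (1 - 0) := h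
      _ = S * ‖y‖ * ‖y‖ := by ring
      _ ≤ S * r * ‖y‖ := by
        have := mul_le_mul_of_nonneg_left hy hS0
        exact mul_le_mul_of_nonneg_right this (norm_nonneg _)
      _ ≤ S * r * ‖y‖ + δ * ‖y‖ ^ 2 := by nlinarith [sq_nonneg ‖y‖]
  · have hyr : r < ‖y‖ := not_le.1 hy
    have hy0 : 0 < ‖y‖ := hr.trans_lt hyr
    set t₀ : ℝ := r / ‖y‖ with ht₀
    have ht₀0 : 0 ≤ t₀ := div_nonneg hr hy0.le
    have ht₀1 : t₀ ≤ 1 := (div_le_one hy0).2 hyr.le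
    -- `[0, t₀]`: bound `S`
    have h1 : |g t₀ - g 0| ≤ S * ‖y‖ ^ 2 * (t₀ - 0) := mvt 0 t₀ S ht₀0 fun t _ => hS _ _
    -- `[t₀, 1]`: points `t y` with `t ≥ t₀` have norm `≥ r`, bound `δ`
    have h2 : |g 1 - g t₀| ≤ δ * ‖y‖ ^ 2 * (1 - t₀) := by
      refine mvt t₀ 1 δ ht₀1 fun t ht => hsmall _ ?_ _
      have ht0 : 0 ≤ t := ht₀0.trans ht.1
      rw [norm_smul, Real.norm_of_nonneg ht0]
      calc r = t₀ * ‖y‖ := by rw [ht₀, div_mul_cancel₀ _ hy0.ne']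
        _ ≤ t * ‖y‖ := mul_le_mul_of_nonneg_right ht.1 hy0.le
    have e1 : S * ‖y‖ ^ 2 * (t₀ - 0) = S * r * ‖y‖ := by
      rw [ht₀]; field_simp; ring
    calc |g 1 - g 0| = |(g 1 - g t₀) + (g t₀ - g 0)| := by ring_nf
      _ ≤ |g 1 - g t₀| + |g t₀ - g 0| := abs_add_le _ _
      _ ≤ δ * ‖y‖ ^ 2 * (1 - t₀) + S * ‖y‖ ^ 2 * (t₀ - 0) := add_le_add h2 h1
      _ ≤ δ * ‖y‖ ^ 2 + S * r * ‖y‖ := by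
          rw [e1]
          have : δ * ‖y‖ ^ 2 * (1 - t₀) ≤ δ * ‖y‖ ^ 2 := by
            have hδy : 0 ≤ δ * ‖y‖ ^ 2 := by positivity
            nlinarith
          linarith
      _ = S * r * ‖y‖ + δ * ‖y‖ ^ 2 := by ring

end Radial

/-! ### Symmetric Jacobian from vanishing curl -/

/-- If `curl U y = 0` then the Jacobian is symmetric there: `DU(y) = ½(DU(y) + DU(y)ᵀ)`
(`‖curl U y‖² = ½ |DU − DUᵀ|²_F`, `norm_curl_sq_eq_frobeniusNormSq_spin_holds`). [folklore] -/
private theorem fderiv_eq_strain_of_curl_eq_zero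
    {U : EuclideanSpace ℝ (Fin 3) → EuclideanSpace ℝ (Fin 3)} {y : EuclideanSpace ℝ (Fin 3)}
    (hU : DifferentiableAt ℝ U y) (hcurl : curl U y = 0) :
    fderiv ℝ U y =
      (1 / 2 : ℝ) • (fderiv ℝ U y + ContinuousLinearMap.adjoint (fderiv ℝ U y)) := by
  have h1 := norm_curl_sq_eq_frobeniusNormSq_spin_holds U y hU
  rw [hcurl, norm_zero] at h1
  have h2 : frobeniusNormSq (spin U y) = 0 := by
    have : (0 : ℝ) ^ 2 = 0 := by norm_num
    rw [this] at h1
    linarith [frobeniusNormSq_nonneg (spin U y)]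
  have h3 : spin U y = 0 := eq_zero_of_frobeniusNormSq_eq_zero h2
  have h3' : fderiv ℝ U y - ContinuousLinearMap.adjoint (fderiv ℝ U y) = 0 := by
    rw [spin] at h3
    convert h3 using 2
  have h4 : ContinuousLinearMap.adjoint (fderiv ℝ U y) = fderiv ℝ U y := (sub_eq_zero.1 h3').symm
  rw [h4, ← two_smul ℝ (fderiv ℝ U y), smul_smul]
  norm_num

/-! ### Functions tending to zero at infinity -/

section Cocompact

variable {X : Type*} [NormedAddCommGroup X] [ProperSpace X]

omit [ProperSpace X] in
/-- A real function tending to `0` along the cocompact filter of a proper normed group is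
eventually `≤ δ` outside a ball: `∃ r ≥ 0, ∀ z, r ≤ ‖z‖ → f z ≤ δ`. [folklore] -/
private theorem exists_forall_le_of_tendsto_cocompact {f : X → ℝ}
    (hf : Tendsto f (cocompact X) (𝓝 0)) {δ : ℝ} (hδ : 0 < δ) :
    ∃ r : ℝ, 0 ≤ r ∧ ∀ z : X, r ≤ ‖z‖ → f z ≤ δ := by
  have hev : {z : X | f z ≤ δ} ∈ cocompact X := hf (Iic_mem_nhds hδ)
  obtain ⟨K, hK, hKs⟩ := mem_cocompact.1 hev
  obtain ⟨r, hr0, hKr⟩ := hK.isBounded.subset_closedBall_lt 0 (0 : X)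
  refine ⟨r + 1, by linarith, fun z hz => ?_⟩
  have hzK : z ∉ K := fun hzK => by
    have h := hKr hzK
    rw [mem_closedBall, dist_zero_right] at h
    linarith
  exact hKs hzK

/-- A continuous real function tending to `0` along the cocompact filter of a proper normed group
is bounded above: `∃ S ≥ 0, ∀ z, f z ≤ S`. [folklore] -/
private theorem exists_forall_le_of_continuous_of_tendsto_cocompact {f : X → ℝ} (hc : Continuous f)
    (hf : Tendsto f (cocompact X) (𝓝 0)) : ∃ S : ℝ, 0 ≤ S ∧ ∀ z : X, f z ≤ S := by
  obtain ⟨r₁, _, h₁⟩ := exists_forall_le_of_tendsto_cocompact hf one_pos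
  obtain ⟨K₁, hK₁⟩ := (isCompact_closedBall (0 : X) r₁).bddAbove_image hc.continuousOn
  refine ⟨max K₁ 1, le_max_of_le_right zero_le_one, fun z => ?_⟩
  by_cases hz : r₁ ≤ ‖z‖
  · exact (h₁ z hz).trans (le_max_right _ _)
  · have hzb : z ∈ closedBall (0 : X) r₁ := by
      rw [mem_closedBall_zero_iff]
      exact (not_le.1 hz).le
    exact (hK₁ (Set.mem_image_of_mem _ hzb)).trans (le_max_left _ _)

end Cocompact

/-! ### The fact -/

/-- **Chae–Shvydkoy 2013, Theorem 4.1, discharged.** For `α > −1`, `0 < p < 3/(1+α)`, a stationary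
self-similar Euler profile `(U, P)` with exponent `1/(α+1)` and centre `0` (`U ∈ C²`, `P ∈ C¹`,
`α/(1+α) U + 1/(1+α) (y·∇)U + (U·∇)U + ∇P = 0`, `div U = 0`) whose strain `½(DU + DUᵀ)` tends to
`0` at infinity and whose vorticity `curl U` lies in `L^p(ℝ³)` is a constant vector field.
Proof: the tree's exterior identity / compact-support Liouville / sublinear harmonic Liouville
chain (module docstring). [cite: ChaeShvydkoy2013, §4 Thm. 4.1] -/
theorem chaeShvydkoy2013_vorticity_exclusion_holds : chaeShvydkoy2013_vorticity_exclusion := by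
  intro α p U P hα hp hp3 hprof hstrain hΩp
  -- notation
  have hα1 : 0 < α + 1 := by linarith
  set γ : ℝ := 1 / (α + 1) with hγdef
  have hγ : 0 < γ := by rw [hγdef]; positivity
  have hU2 : ContDiff ℝ 2 U := hprof.contDiff_velocity
  have hUd : Differentiable ℝ U := hprof.differentiable_velocity
  have hV := hprof.isSelfSimilarEulerVorticityProfile
  -- the strain is continuous, bounded (`S`) and eventually small
  have hςc : Continuous fun y => ‖(1 / 2 : ℝ) •
      (fderiv ℝ U y + ContinuousLinearMap.adjoint (fderiv ℝ U y))‖ := by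
    have hDU : Continuous (fderiv ℝ U) := hU2.continuous_fderiv (by norm_num)
    have hadj : Continuous fun y => ContinuousLinearMap.adjoint (fderiv ℝ U y) :=
      (ContinuousLinearMap.adjoint (𝕜 := ℝ) (E := EuclideanSpace ℝ (Fin 3))
        (F := EuclideanSpace ℝ (Fin 3))).continuous.comp hDU
    have hsum : Continuous fun y => fderiv ℝ U y + ContinuousLinearMap.adjoint (fderiv ℝ U y) :=
      hDU.add hadj
    have hsm : Continuous fun y => (1 / 2 : ℝ) •
        (fderiv ℝ U y + ContinuousLinearMap.adjoint (fderiv ℝ U y)) := hsum.const_smul (1 / 2 : ℝ)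
    exact hsm.norm
  obtain ⟨S, hS0, hS⟩ := exists_forall_le_of_continuous_of_tendsto_cocompact hςc hstrain
  have hsmall := fun (δ : ℝ) (hδ : 0 < δ) => exists_forall_le_of_tendsto_cocompact hstrain hδ
  -- quadratic-form bounds from the strain
  have hqS : ∀ z w : EuclideanSpace ℝ (Fin 3), |⟪fderiv ℝ U z w, w⟫| ≤ S * ‖w‖ ^ 2 := fun z w =>
    (abs_inner_apply_self_le_norm_strain_mul _ _).trans
      (mul_le_mul_of_nonneg_right (hS z) (sq_nonneg _))
  have hqδ : ∀ δ : ℝ, 0 < δ → ∃ r : ℝ, 0 ≤ r ∧ ∀ z : EuclideanSpace ℝ (Fin 3), r ≤ ‖z‖ →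
      ∀ w : EuclideanSpace ℝ (Fin 3), |⟪fderiv ℝ U z w, w⟫| ≤ δ * ‖w‖ ^ 2 := by
    intro δ hδ
    obtain ⟨r, hr, h⟩ := hsmall δ hδ
    exact ⟨r, hr, fun z hz w => (abs_inner_apply_self_le_norm_strain_mul _ _).trans
      (mul_le_mul_of_nonneg_right (h z hz) (sq_nonneg _))⟩
  -- (H2) quadratic growth of the radial transport `⟪γ y + U y, y⟫`
  have hgrowth : ∃ C : ℝ, ∀ y : EuclideanSpace ℝ (Fin 3),
      |⟪selfSimilarTransport γ 0 U y, y - 0⟫| ≤ C * (1 + ‖y - 0‖ ^ 2) := by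
    refine ⟨|γ| + ‖U 0‖ + S, fun y => ?_⟩
    rw [sub_zero, selfSimilarTransport_apply, sub_zero, inner_add_left, inner_smul_left]
    simp only [conj_trivial, real_inner_self_eq_norm_sq]
    have h1 := abs_inner_sub_inner_zero_le_of_strain hUd hS0 hqS hS0 le_rfl (fun z _ w => hqS z w) y
    rw [mul_zero, zero_mul, zero_add] at h1
    have h2 : |⟪U 0, y⟫| ≤ ‖U 0‖ * ‖y‖ := abs_real_inner_le_norm _ _
    have h3 : ‖y‖ ≤ 1 + ‖y‖ ^ 2 := by nlinarith [norm_nonneg y, sq_nonneg (‖y‖ - 1)]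
    have h4 : |⟪U y, y⟫| ≤ ‖U 0‖ * ‖y‖ + S * ‖y‖ ^ 2 := by
      have := abs_sub_abs_le_abs_sub ⟪U y, y⟫ ⟪U 0, y⟫
      linarith
    calc |γ * ‖y‖ ^ 2 + ⟪U y, y⟫| ≤ |γ * ‖y‖ ^ 2| + |⟪U y, y⟫| := abs_add_le _ _
      _ ≤ |γ| * ‖y‖ ^ 2 + (‖U 0‖ * ‖y‖ + S * ‖y‖ ^ 2) := by
          rw [abs_mul, abs_of_nonneg (sq_nonneg ‖y‖)]; linarith
      _ ≤ (|γ| + ‖U 0‖ + S) * (1 + ‖y‖ ^ 2) := by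
          have hγ0 := abs_nonneg γ
          have hU0 := norm_nonneg (U 0)
          nlinarith [sq_nonneg ‖y‖, mul_le_mul_of_nonneg_left h3 hU0]
  -- (H1) eventual outward radial transport
  have hout : ∃ R₀ : ℝ, 0 < R₀ ∧ ∀ y : EuclideanSpace ℝ (Fin 3), R₀ ≤ ‖y - 0‖ →
      0 ≤ ⟪selfSimilarTransport γ 0 U y, y - 0⟫ := by
    obtain ⟨r, hr, hδ⟩ := hqδ (γ / 4) (by positivity)
    refine ⟨4 * (‖U 0‖ + S * r) / (3 * γ) + 1, by positivity, fun y hy => ?_⟩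
    rw [sub_zero] at hy
    rw [sub_zero, selfSimilarTransport_apply, sub_zero, inner_add_left, inner_smul_left]
    simp only [conj_trivial, real_inner_self_eq_norm_sq]
    have h1 := abs_inner_sub_inner_zero_le_of_strain hUd hS0 hqS (by positivity) hr hδ y
    have h2 : |⟪U 0, y⟫| ≤ ‖U 0‖ * ‖y‖ := abs_real_inner_le_norm _ _
    have h3 : -(‖U 0‖ * ‖y‖) - (S * r * ‖y‖ + γ / 4 * ‖y‖ ^ 2) ≤ ⟪U y, y⟫ := by
      have := (abs_le.1 h1).1
      have := (abs_le.1 h2).1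
      linarith
    have hy' : 4 * (‖U 0‖ + S * r) ≤ 3 * γ * ‖y‖ := by
      have h4 : 4 * (‖U 0‖ + S * r) / (3 * γ) ≤ ‖y‖ := by linarith
      rw [div_le_iff₀ (by positivity)] at h4
      linarith
    nlinarith [norm_nonneg y, mul_nonneg (norm_nonneg (U 0)) (norm_nonneg y)]
  -- (H3) eventually small stretching
  have hstretch : ∀ η : ℝ, 0 < η → ∃ R₁ : ℝ, ∀ y : EuclideanSpace ℝ (Fin 3), R₁ ≤ ‖y - 0‖ →
      |⟪curl U y, fderiv ℝ U y (curl U y)⟫| ≤ η * ‖curl U y‖ ^ 2 := by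
    intro η hη
    obtain ⟨r, _, hδ⟩ := hqδ η hη
    refine ⟨r, fun y hy => ?_⟩
    rw [sub_zero] at hy
    rw [real_inner_comm]
    exact hδ y hy (curl U y)
  -- `|curl U|^p = (|curl U|²)^{p/2} ∈ L¹`
  have hint : Integrable (fun y => (‖curl U y‖ ^ 2) ^ (p / 2)) := by
    have h := hΩp.integrable_norm_rpow (by simp [ENNReal.ofReal_eq_zero, not_le.2 hp])
      ENNReal.ofReal_ne_top
    rw [ENNReal.toReal_ofReal hp.le] at h
    refine h.congr (ae_of_all _ fun y => ?_)
    simp only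
    rw [← Real.rpow_natCast, ← Real.rpow_mul (norm_nonneg _)]
    congr 1
    push_cast
    ring
  -- steps 1 + 2: the vorticity vanishes identically
  have ha : 0 < p / 2 := half_pos hp
  have haγ : 2 * (p / 2) < 3 * γ := by
    rw [hγdef]
    have : 3 / (1 + α) = 3 * (1 / (α + 1)) := by rw [add_comm]; ring
    linarith
  have hcurl0 : curl U = 0 := hV.curl_eq_zero_of_integrable_rpow ha haγ hint hout hgrowth hstretch
  have hcurl : ∀ x, curl U x = 0 := fun x => congrFun hcurl0 x
  -- step 3: `DU = ς → 0`, irrotational + incompressible ⇒ constant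
  have hD : Tendsto (fun y => ‖fderiv ℝ U y‖) (cocompact (EuclideanSpace ℝ (Fin 3))) (𝓝 0) := by
    refine hstrain.congr fun y => ?_
    rw [← fderiv_eq_strain_of_curl_eq_zero (hUd y) (hcurl y)]
  refine ⟨U 0, fun y => ?_⟩
  exact eq_of_curl_eq_zero_of_isDivFree_of_fderiv_tendsto_zero hU2 hcurl hprof.divFree hD y 0

end Literature.Analysis.FluidPDE

end
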